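import Summits.ValiantsHypothesis.ValiantsHypothesis.Theorems.BarrierLeverTropicalDetCertificatesExistNearPrincipalBlocks

/-!
# Route BarrierLever — item `DescentCertificateSuffices` (stmt-ValiantsHypothesis-19573),
# part 1/2: the DESCENT WEIGHT, label sets, and the block LOWER bound

Helper file (`--supports stmt-ValiantsHypothesis-19573`; cell valiant-natproofs, rung V4, 𝒟-side;
prover seat val-np-p1; statement and proof sketch by planner p1-g9, memo `HOME/p1/UTD-memo-g9.md`
§3(o)). Closes NO item; part 2/2 (`BarrierLeverDescentCertificateSuffices.lean`) proves the block
upper bound, the outer comparison and the item.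

**Setting.** Row literals `ρ_x a = castAdd h a` if `a ∈ x` else `natAdd h a` (`rowL`), column
literals `κ_y c = natAdd h c` if `c ∈ y` else `castAdd h c` (`colL`), for cube points
`x, y : Finset (Fin h)`; they are decoded to (coordinate, bit) pairs by `rowDec` / `colDec` of the
near-principal file. Given a valuation `e` of literal pairs and a constant `B`, the DESCENT WEIGHT
`dwt e B` on `Fin (h+h) × Fin (h+h)` is `0` on FORWARD pairs (row coordinate `<` column coordinate)
and on AGREEMENT pairs (same coordinate, same bit), and `B + e` on BACKWARD pairs and on mismatched
diagonal pairs (LOOPS) (`dwt_lit`). The cost of an inner assignment `τ : Perm (Fin h)` for the block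
(row point `x`, column point `y`) is `bcost e B x y τ = Σ_a dwt e B (ρ_x a) (κ_y (τ a))`; its
minimum over `τ` is the tropical determinant of the block in the sense of items 19315 / 19316.
The LABEL SET `labels e x y` (verbatim the shape of the item's hypothesis) collects the
`e`-values of the backward literal pairs `(ρ_x a, κ_y c)`, `c < a`, `[c, a] ⊇ M`, and of the loop
`(ρ_x m, κ_y m)` when the mismatch set `M = x ∆ y` is `{m}`; it is nonempty as soon as `x ≠ y`
(`labels_nonempty`).

**Main result (BLOCK LOWER BOUND, `le_bcost`).** If `e ≤ B` and `x ≠ y`, every inner assignment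
`τ` costs `≥ B + min (labels e x y)`: `τ` pays `≥ B` at each descent (`τ m < m`) and at each fixed
mismatch coordinate; two payments give `2B ≥ B + min`; no payment is impossible (a permutation
without descents is the identity, `eq_one_of_forall_le`, and then a mismatch coordinate is fixed);
exactly one payment is either a fixed mismatch `s` with `τ = 1` and `M = {s}` — the loop label — or
a unique descent `s` with no fixed mismatch, and then every moved coordinate lies in `[τ s, s]`
(the largest moved coordinate is a descent; the preimage of the smallest one is a descent), so
`(s, τ s)` is a backward label. Identity blocks cost `0` at the identity (`bcost_one_self`).

WHAT THIS IS NOT: no statement about layouts yet (part 2); nothing on UT-D in general (item 19316),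
on TT / TNS / item 19717, on crux stmt-ValiantsHypothesis-14610, or on `VP` versus `VNP`.
-/

-- layout Summits/ValiantsHypothesis/ValiantsHypothesis forces the duplicated namespace component
set_option linter.dupNamespace false

namespace Summit.ValiantsHypothesis.ValiantsHypothesis.Theorems.BarrierLever.Descent

open Finset
open Summit.ValiantsHypothesis.ValiantsHypothesis.Theorems.BarrierLever.NearPrincipal

variable {h : ℕ}

/-! ## 1. Literals and the descent weight -/

/-- The row literal of coordinate `a` for the row point `x`: `castAdd h a` if `a ∈ x`,
else `natAdd h a` (verbatim the encoding of the route's statements). -/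
def rowL (x : Finset (Fin h)) (a : Fin h) : Fin (h + h) :=
  if a ∈ x then Fin.castAdd h a else Fin.natAdd h a

/-- The column literal of coordinate `c` for the column point `y`: `natAdd h c` if `c ∈ y`,
else `castAdd h c`. -/
def colL (y : Finset (Fin h)) (c : Fin h) : Fin (h + h) :=
  if c ∈ y then Fin.natAdd h c else Fin.castAdd h c

/-- Decoding a row literal gives back (coordinate, bit). -/
theorem rowDec_rowL (x : Finset (Fin h)) (a : Fin h) : rowDec (rowL x a) = (a, decide (a ∈ x)) := by
  unfold rowL
  by_cases ha : a ∈ x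
  · rw [if_pos ha, rowDec_castAdd, decide_eq_true ha]
  · rw [if_neg ha, rowDec_natAdd, decide_eq_false ha]

/-- Decoding a column literal gives back (coordinate, bit). -/
theorem colDec_colL (y : Finset (Fin h)) (c : Fin h) : colDec (colL y c) = (c, decide (c ∈ y)) := by
  unfold colL
  by_cases hc : c ∈ y
  · rw [if_pos hc, colDec_natAdd, decide_eq_true hc]
  · rw [if_neg hc, colDec_castAdd, decide_eq_false hc]

/-- The DESCENT WEIGHT built from a valuation `e` of literal pairs and a constant `B`: `0` on
forward pairs (row coordinate `<` column coordinate) and on agreement pairs (same coordinate, same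
bit); `B + e x y` on backward pairs and on mismatched diagonal pairs (loops). -/
def dwt (e : Fin (h + h) → Fin (h + h) → ℕ) (B : ℕ) (x y : Fin (h + h)) : ℕ :=
  if (rowDec x).1 < (colDec y).1 ∨ ((rowDec x).1 = (colDec y).1 ∧ (rowDec x).2 = (colDec y).2)
  then 0 else B + e x y

/-- The descent weight on a (row literal, column literal) pair of coordinates `a`, `c`. -/
theorem dwt_lit (e : Fin (h + h) → Fin (h + h) → ℕ) (B : ℕ) (x y : Finset (Fin h)) (a c : Fin h) :
    dwt e B (rowL x a) (colL y c) =
      if a < c ∨ (a = c ∧ (a ∈ x ↔ c ∈ y)) then 0 else B + e (rowL x a) (colL y c) := by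
  unfold dwt
  rw [rowDec_rowL, colDec_colL]
  dsimp only
  by_cases H : a < c ∨ (a = c ∧ (a ∈ x ↔ c ∈ y))
  · rw [if_pos H, if_pos]
    rcases H with H | ⟨H1, H2⟩
    · exact Or.inl H
    · exact Or.inr ⟨H1, decide_eq_decide.mpr H2⟩
  · rw [if_neg H, if_neg]
    rintro (H' | ⟨H1, H2⟩)
    · exact H (Or.inl H')
    · exact H (Or.inr ⟨H1, decide_eq_decide.mp H2⟩)

/-- Forward pairs are free. -/
theorem dwt_lit_fwd (e : Fin (h + h) → Fin (h + h) → ℕ) (B : ℕ) (x y : Finset (Fin h))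
    {a c : Fin h} (hac : a < c) : dwt e B (rowL x a) (colL y c) = 0 := by
  rw [dwt_lit, if_pos (Or.inl hac)]

/-- Agreement pairs are free. -/
theorem dwt_lit_agree (e : Fin (h + h) → Fin (h + h) → ℕ) (B : ℕ) (x y : Finset (Fin h))
    {a : Fin h} (ha : (a ∈ x ↔ a ∈ y)) : dwt e B (rowL x a) (colL y a) = 0 := by
  rw [dwt_lit, if_pos (Or.inr ⟨rfl, ha⟩)]

/-- Backward pairs cost `B + e`. -/
theorem dwt_lit_bwd (e : Fin (h + h) → Fin (h + h) → ℕ) (B : ℕ) (x y : Finset (Fin h))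
    {a c : Fin h} (hca : c < a) : dwt e B (rowL x a) (colL y c) = B + e (rowL x a) (colL y c) := by
  rw [dwt_lit, if_neg]
  rintro (H | ⟨H, -⟩)
  · exact lt_asymm H hca
  · rw [H] at hca
    exact lt_irrefl _ hca

/-- Mismatched diagonal pairs (loops) cost `B + e`. -/
theorem dwt_lit_loop (e : Fin (h + h) → Fin (h + h) → ℕ) (B : ℕ) (x y : Finset (Fin h))
    {a : Fin h} (ha : ¬ (a ∈ x ↔ a ∈ y)) :
    dwt e B (rowL x a) (colL y a) = B + e (rowL x a) (colL y a) := by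
  rw [dwt_lit, if_neg]
  rintro (H | ⟨-, H⟩)
  · exact lt_irrefl _ H
  · exact ha H

/-- A coordinate is a mismatch coordinate of the block `(x, y)` iff its bits disagree. -/
theorem mismatch_iff (x y : Finset (Fin h)) (m : Fin h) : (m ∈ x ↔ m ∉ y) ↔ ¬ (m ∈ x ↔ m ∈ y) := by
  tauto

/-! ## 2. Block costs and label sets -/

/-- The cost of the inner assignment `τ` for the block (row point `x`, column point `y`):
`Σ_a dwt e B (ρ_x a) (κ_y (τ a))`. -/
def bcost (e : Fin (h + h) → Fin (h + h) → ℕ) (B : ℕ) (x y : Finset (Fin h))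
    (τ : Equiv.Perm (Fin h)) : ℕ :=
  ∑ a, dwt e B (rowL x a) (colL y (τ a))

/-- An identity block costs `0` at the identity assignment. -/
theorem bcost_one_self (e : Fin (h + h) → Fin (h + h) → ℕ) (B : ℕ) (x : Finset (Fin h)) :
    bcost e B x x 1 = 0 :=
  Finset.sum_eq_zero (fun a _ => by
    rw [Equiv.Perm.coe_one, id]; exact dwt_lit_agree e B x x Iff.rfl)

/-- The LABEL SET of the block `(x, y)` under the valuation `e` (verbatim the shape of the item's
hypothesis): the `e`-values of the backward literal pairs `(ρ_x a, κ_y c)`, `c < a`,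
`[c, a] ⊇ M`, and of the loop `(ρ_x a, κ_y a)` when the mismatch set `M` is `{a}`. -/
def labels (e : Fin (h + h) → Fin (h + h) → ℕ) (x y : Finset (Fin h)) : Set ℕ :=
  {n : ℕ | ∃ a c : Fin h,
    ((c < a ∧ (∀ m : Fin h, (m ∈ x ↔ m ∉ y) → m ≤ a) ∧ (∀ m : Fin h, (m ∈ x ↔ m ∉ y) → c ≤ m))
      ∨ (a = c ∧ ∀ m : Fin h, (m ∈ x ↔ m ∉ y) ↔ m = a)) ∧
    n = e (if a ∈ x then Fin.castAdd h a else Fin.natAdd h a)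
          (if c ∈ y then Fin.natAdd h c else Fin.castAdd h c)}

/-- Backward labels. -/
theorem mem_labels_bwd (e : Fin (h + h) → Fin (h + h) → ℕ) (x y : Finset (Fin h)) {a c : Fin h}
    (hca : c < a) (hub : ∀ m : Fin h, (m ∈ x ↔ m ∉ y) → m ≤ a)
    (hlb : ∀ m : Fin h, (m ∈ x ↔ m ∉ y) → c ≤ m) :
    e (rowL x a) (colL y c) ∈ labels e x y :=
  ⟨a, c, Or.inl ⟨hca, hub, hlb⟩, rfl⟩

/-- Loop labels. -/
theorem mem_labels_loop (e : Fin (h + h) → Fin (h + h) → ℕ) (x y : Finset (Fin h)) {a : Fin h}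
    (hM : ∀ m : Fin h, (m ∈ x ↔ m ∉ y) ↔ m = a) :
    e (rowL x a) (colL y a) ∈ labels e x y :=
  ⟨a, a, Or.inr ⟨rfl, hM⟩, rfl⟩

/-- The label minimum is bounded by any bound on `e`. -/
theorem sInf_labels_le (e : Fin (h + h) → Fin (h + h) → ℕ) (x y : Finset (Fin h)) (E : ℕ)
    (hE : ∀ p q, e p q ≤ E) : sInf (labels e x y) ≤ E := by
  rcases (labels e x y).eq_empty_or_nonempty with h0 | hne
  · rw [h0, Nat.sInf_empty]
    exact Nat.zero_le _
  · obtain ⟨a, c, -, hn⟩ := Nat.sInf_mem hne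
    rw [hn]
    exact hE _ _

/-- A block with distinct row and column points has a label (`(max M, min M)` or the loop). -/
theorem labels_nonempty (e : Fin (h + h) → Fin (h + h) → ℕ) (x y : Finset (Fin h)) (hxy : x ≠ y) :
    (labels e x y).Nonempty := by
  set M := univ.filter (fun m => (m ∈ x ↔ m ∉ y)) with hMdef
  have hmemM : ∀ m, m ∈ M ↔ (m ∈ x ↔ m ∉ y) := fun m => by
    rw [hMdef, mem_filter]; simp only [mem_univ, true_and]
  have hMne : M.Nonempty := by
    by_contra hcon
    rw [Finset.not_nonempty_iff_eq_empty] at hcon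
    apply hxy
    ext m
    by_contra hm
    have hmM : m ∈ M := (hmemM m).mpr (by tauto)
    rw [hcon] at hmM
    exact Finset.notMem_empty m hmM
  have hub : ∀ m, (m ∈ x ↔ m ∉ y) → m ≤ M.max' hMne := fun m hm => le_max' M m ((hmemM m).mpr hm)
  have hlb : ∀ m, (m ∈ x ↔ m ∉ y) → M.min' hMne ≤ m := fun m hm => min'_le M m ((hmemM m).mpr hm)
  rcases lt_or_eq_of_le (min'_le M (M.max' hMne) (max'_mem M hMne)) with hca | hca
  · exact ⟨_, mem_labels_bwd e x y hca hub hlb⟩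
  · refine ⟨_, mem_labels_loop e x y (a := M.max' hMne) (fun m => ⟨fun hm => ?_, ?_⟩)⟩
    · exact le_antisymm (hub m hm) (hca ▸ hlb m hm)
    · rintro rfl
      exact (hmemM _).mp (max'_mem M hMne)

/-! ## 3. The block lemma: lower bound -/

/-- A permutation of `Fin h` without descents is the identity. -/
theorem eq_one_of_forall_le (τ : Equiv.Perm (Fin h)) (hτ : ∀ m, m ≤ τ m) : τ = 1 := by
  have hsum : ∑ m, ((m : Fin h) : ℕ) = ∑ m, ((τ m : Fin h) : ℕ) :=
    (Equiv.sum_comp τ (fun m => ((m : Fin h) : ℕ))).symm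
  have hle : ∀ m ∈ (univ : Finset (Fin h)), ((m : Fin h) : ℕ) ≤ ((τ m : Fin h) : ℕ) :=
    fun m _ => Fin.le_def.mp (hτ m)
  have heq := (Finset.sum_eq_sum_iff_of_le hle).mp hsum
  refine Equiv.ext (fun m => ?_)
  rw [Equiv.Perm.coe_one, id]
  exact Fin.ext (heq m (mem_univ m)).symm

/-- BLOCK LOWER BOUND: if `e ≤ B` and the block `(x, y)` has a mismatch, every inner assignment
costs at least `B + min (labels e x y)`. -/
theorem le_bcost (e : Fin (h + h) → Fin (h + h) → ℕ) (B : ℕ) (hB : ∀ p q, e p q ≤ B)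
    (x y : Finset (Fin h)) (hxy : x ≠ y) (τ : Equiv.Perm (Fin h)) :
    B + sInf (labels e x y) ≤ bcost e B x y τ := by
  have hinf : sInf (labels e x y) ≤ B := sInf_labels_le e x y B hB
  -- a mismatch coordinate exists
  have hM : ∃ m, (m ∈ x ↔ m ∉ y) := by
    by_contra hcon
    apply hxy
    ext m
    by_contra hm
    exact hcon ⟨m, by tauto⟩
  -- the terms and the paying coordinates
  set f : Fin h → ℕ := fun m => dwt e B (rowL x m) (colL y (τ m)) with hf
  have hbc : bcost e B x y τ = ∑ m, f m := rfl
  have hpay_desc : ∀ m, τ m < m → f m = B + e (rowL x m) (colL y (τ m)) :=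
    fun m hm => dwt_lit_bwd e B x y hm
  have hpay_fix : ∀ m, τ m = m → (m ∈ x ↔ m ∉ y) → f m = B + e (rowL x m) (colL y m) := by
    intro m hfix hmis
    show dwt e B (rowL x m) (colL y (τ m)) = _
    rw [hfix]
    exact dwt_lit_loop e B x y ((mismatch_iff x y m).mp hmis)
  set S := univ.filter (fun m => τ m < m ∨ (τ m = m ∧ (m ∈ x ↔ m ∉ y))) with hS
  have hmemS : ∀ m, m ∈ S ↔ τ m < m ∨ (τ m = m ∧ (m ∈ x ↔ m ∉ y)) := fun m => by
    rw [hS, mem_filter]; simp only [mem_univ, true_and]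
  have hSB : ∀ m ∈ S, B ≤ f m := by
    intro m hm
    rcases (hmemS m).mp hm with hlt | ⟨hfix, hmis⟩
    · rw [hpay_desc m hlt]; exact Nat.le_add_right _ _
    · rw [hpay_fix m hfix hmis]; exact Nat.le_add_right _ _
  have hsumS : S.card * B ≤ ∑ m, f m :=
    calc S.card * B = ∑ m ∈ S, B := by rw [sum_const, smul_eq_mul]
      _ ≤ ∑ m ∈ S, f m := sum_le_sum hSB
      _ ≤ ∑ m, f m := sum_le_sum_of_subset_of_nonneg (subset_univ _) (fun _ _ _ => Nat.zero_le _)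
  have hfs : ∀ s, f s ≤ ∑ m, f m := fun s => single_le_sum (fun _ _ => Nat.zero_le _) (mem_univ s)
  rw [hbc]
  by_cases h2 : 2 ≤ S.card
  · -- two paying coordinates already exceed `B + labelmin`
    calc B + sInf (labels e x y) ≤ B + B := Nat.add_le_add_left hinf _
      _ = 2 * B := (two_mul B).symm
      _ ≤ S.card * B := Nat.mul_le_mul_right _ h2
      _ ≤ ∑ m, f m := hsumS
  -- otherwise exactly one paying coordinate `s`
  have hone : (∀ m, ¬ τ m < m) → τ = 1 := fun hnd =>
    eq_one_of_forall_le τ (fun m => not_lt.mp (hnd m))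
  have hSne : S.Nonempty := by
    by_contra hemp
    rw [Finset.not_nonempty_iff_eq_empty] at hemp
    have h1 : τ = 1 := hone (fun m hm => by
      have hmS : m ∈ S := (hmemS m).mpr (Or.inl hm)
      rw [hemp] at hmS
      exact Finset.notMem_empty m hmS)
    obtain ⟨m₀, hm₀⟩ := hM
    have hm₀S : m₀ ∈ S := (hmemS m₀).mpr (Or.inr ⟨by rw [h1]; rfl, hm₀⟩)
    rw [hemp] at hm₀S
    exact Finset.notMem_empty m₀ hm₀S
  obtain ⟨s, hSs⟩ : ∃ s, S = {s} := by
    rw [← Finset.card_eq_one]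
    have := hSne.card_pos
    omega
  have hsS : s ∈ S := by rw [hSs]; exact mem_singleton_self s
  have huniq : ∀ m ∈ S, m = s := fun m hm => by rw [hSs] at hm; exact mem_singleton.mp hm
  rcases (hmemS s).mp hsS with hlt | ⟨hfix, hmis⟩
  · -- `s` is the unique descent and no mismatch coordinate is fixed
    have hdesc_eq : ∀ m, τ m < m → m = s := fun m hm => huniq m ((hmemS m).mpr (Or.inl hm))
    set T := univ.filter (fun m => τ m ≠ m) with hT
    have hmemT : ∀ m, m ∈ T ↔ τ m ≠ m := fun m => by
      rw [hT, mem_filter]; simp only [mem_univ, true_and]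
    have hTne : T.Nonempty := ⟨s, (hmemT s).mpr hlt.ne⟩
    -- every moved coordinate is `≤ s` (the largest moved coordinate is a descent) …
    have hmax : ∀ m ∈ T, m ≤ s := by
      have hm1 : T.max' hTne ∈ T := max'_mem T hTne
      have hmoved : τ (T.max' hTne) ≠ T.max' hTne := (hmemT _).mp hm1
      have hm2 : τ (T.max' hTne) ∈ T := (hmemT _).mpr (fun heq => hmoved (τ.injective heq))
      have hm3 : τ (T.max' hTne) ≤ T.max' hTne := le_max' T _ hm2
      have hm4 : T.max' hTne = s := hdesc_eq _ (lt_of_le_of_ne hm3 hmoved)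
      intro m hm
      rw [← hm4]
      exact le_max' T m hm
    -- … and `≥ τ s` (the preimage of the smallest moved coordinate is a descent)
    have hmin : ∀ m ∈ T, τ s ≤ m := by
      have hm1 : T.min' hTne ∈ T := min'_mem T hTne
      have hmoved : τ (T.min' hTne) ≠ T.min' hTne := (hmemT _).mp hm1
      have hpre : τ (τ.symm (T.min' hTne)) = T.min' hTne := Equiv.apply_symm_apply _ _
      have hpre_ne : τ.symm (T.min' hTne) ≠ T.min' hTne := fun heq =>
        hmoved (by rw [heq] at hpre; exact hpre)
      have hpre_T : τ.symm (T.min' hTne) ∈ T := (hmemT _).mpr (by rw [hpre]; exact hpre_ne.symm)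
      have hle1 : T.min' hTne ≤ τ.symm (T.min' hTne) := min'_le T _ hpre_T
      have hlt1 : τ (τ.symm (T.min' hTne)) < τ.symm (T.min' hTne) := by
        rw [hpre]; exact lt_of_le_of_ne hle1 hpre_ne.symm
      have hs1 : τ.symm (T.min' hTne) = s := hdesc_eq _ hlt1
      have hτs : τ s = T.min' hTne := by rw [← hs1, hpre]
      intro m hm
      rw [hτs]
      exact min'_le T m hm
    have hnofix : ∀ m, (m ∈ x ↔ m ∉ y) → τ m ≠ m := by
      intro m hmis hfix
      have hms := huniq m ((hmemS m).mpr (Or.inr ⟨hfix, hmis⟩))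
      rw [hms] at hfix
      exact hlt.ne hfix
    have hmem : e (rowL x s) (colL y (τ s)) ∈ labels e x y :=
      mem_labels_bwd e x y hlt (fun m hm => hmax m ((hmemT m).mpr (hnofix m hm)))
        (fun m hm => hmin m ((hmemT m).mpr (hnofix m hm)))
    calc B + sInf (labels e x y) ≤ B + e (rowL x s) (colL y (τ s)) :=
          Nat.add_le_add_left (Nat.sInf_le hmem) _
      _ = f s := (hpay_desc s hlt).symm
      _ ≤ ∑ m, f m := hfs s
  · -- `s` is a fixed mismatch coordinate; then `τ = 1` and the mismatch set is `{s}`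
    have h1 : τ = 1 := hone (fun m hm => by
      have hms := huniq m ((hmemS m).mpr (Or.inl hm))
      rw [hms, hfix] at hm
      exact lt_irrefl _ hm)
    have hM1 : ∀ m : Fin h, (m ∈ x ↔ m ∉ y) ↔ m = s := by
      intro m
      constructor
      · intro hm
        exact huniq m ((hmemS m).mpr (Or.inr ⟨by rw [h1]; rfl, hm⟩))
      · rintro rfl
        exact hmis
    have hmem : e (rowL x s) (colL y s) ∈ labels e x y := mem_labels_loop e x y hM1
    calc B + sInf (labels e x y) ≤ B + e (rowL x s) (colL y s) :=
          Nat.add_le_add_left (Nat.sInf_le hmem) _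
      _ = f s := (hpay_fix s hfix hmis).symm
      _ ≤ ∑ m, f m := hfs s

end Summit.ValiantsHypothesis.ValiantsHypothesis.Theorems.BarrierLever.Descent
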